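import Summits.AtomisticToContinuum.FouriersLaw.Theorems.IncoherentChannel.Negative.GibbsStein
import Summits.AtomisticToContinuum.FouriersLaw.Theorems.HiddenChargeMazurThomsonBoundLiouville

/-!
# IncoherentChannel: the Koopman dissipation identity for linear functionals under the Gibbs measure

Support for crux `PhononMeanFreePath.IncoherentChannel` (item stmt-AtomisticToContinuum-11811),
line `two-horizons-forecast-loss`, stub W-C. For EVERY chain `pinnedChain ω₂ lam β γ` (`ω₂ > 0`,
`lam, β ≥ 0`, any `γ`) at temperature `T > 0` and every continuous linear functional `L` on
phase space, with `Y` the Langevin drift (`OscillatorChain.drift`):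
`∫ L · (L ∘ Y) dμ_T = -γ T ∑_i w_i L(e_{p_i})²` (`gibbs_clm_mul_clm_drift`), `w_i` the bath
multiplicity (`OscillatorChain.bathWeight`). Proof: `L ∘ Y = X_H L - γ ∑_i w_i p_i L(e_{p_i})`
with `X_H` the Liouville operator, antisymmetric in `L²(e^{-H/T})` on the `e^{θH}` class
(`ThomsonBound.integral_liouville_mul_eq_neg`), so `∫ L (X_H L) dμ_T = 0`; the friction part is
Stein's identity `∫ p_i L dμ_T = T L(e_{p_i})` (`GibbsStein.gibbs_momentum_mul_clm`).
-/

noncomputable section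

namespace Summit.AtomisticToContinuum.FouriersLaw.Theorems.PhononMeanFreePath

open MeasureTheory Set Filter Topology
open scoped NNReal
open Literature.MathematicalPhysics.KineticTheory.HeatConduction
open Summit.AtomisticToContinuum.FouriersLaw.Theorems.ThomsonBound
open Summit.AtomisticToContinuum.FouriersLaw.Theorems.IncoherentChannel.Negative.GibbsStein
open Summit.AtomisticToContinuum.FouriersLaw.Theorems.IncoherentChannel.Negative.KernelMoments

section Helpers

variable {ω₂ lam β : ℝ} {n : ℕ}

/-- The coordinate vectors of phase space have sup norm at most one. [folklore] -/
theorem norm_unitQ_le_one (i : Fin n) : ‖(unitQ i : PhaseSpace n)‖ ≤ 1 := by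
  rw [unitQ, Prod.norm_mk, norm_zero, Pi.norm_single, norm_one, max_eq_left zero_le_one]

/-- The coordinate vectors of phase space have sup norm at most one. [folklore] -/
theorem norm_unitP_le_one (i : Fin n) : ‖(unitP i : PhaseSpace n)‖ ≤ 1 := by
  rw [unitP, Prod.norm_mk, norm_zero, Pi.norm_single, norm_one, max_eq_right zero_le_one]

/-- **A continuous linear functional lies in the `e^{θH}` growth class** (`θ > 0`):
`|L x| ≤ ‖L‖ (1 + c/θ) e^{θ H(x)}` with `c = 2 max(ω₂⁻¹, 1)` the coercivity constant
(`‖x‖² ≤ c H`). [folklore] -/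
theorem abs_clm_le_exp_hamiltonian (hω : 0 < ω₂) (hl : 0 ≤ lam) (hβ : 0 ≤ β) (γ : ℝ)
    {θ : ℝ} (hθ : 0 < θ) (L : PhaseSpace n →L[ℝ] ℝ) (x : PhaseSpace n) :
    |L x| ≤ ‖L‖ * (1 + 2 * max ω₂⁻¹ 1 / θ) *
      Real.exp (θ * (pinnedChain ω₂ lam β γ).hamiltonian n x) := by
  set H := (pinnedChain ω₂ lam β γ).hamiltonian n x with hH
  set c : ℝ := 2 * max ω₂⁻¹ 1 with hc
  have hH0 : 0 ≤ H := pinnedChain_hamiltonian_nonneg hω.le hl hβ γ n x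
  have hc0 : 0 ≤ c := by positivity
  have hx : ‖x‖ ^ 2 ≤ c * H := norm_sq_le_mul_hamiltonian hω hl hβ γ x
  have h1 : |L x| ≤ ‖L‖ * ‖x‖ := by
    have := L.le_opNorm x; rwa [Real.norm_eq_abs] at this
  have h2 : ‖x‖ ≤ 1 + c * H := by nlinarith [norm_nonneg x, sq_nonneg (‖x‖ - 1)]
  have h3 : θ * H + 1 ≤ Real.exp (θ * H) := Real.add_one_le_exp _
  have h4 : 1 + c * H ≤ (1 + c / θ) * Real.exp (θ * H) := by
    have hcθ : 0 ≤ c / θ := by positivity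
    have e : c * H = c / θ * (θ * H) := by field_simp
    have he1 : 1 ≤ Real.exp (θ * H) := Real.one_le_exp (by positivity)
    rw [e]
    nlinarith
  calc |L x| ≤ ‖L‖ * ‖x‖ := h1
    _ ≤ ‖L‖ * (1 + c * H) := by gcongr
    _ ≤ ‖L‖ * ((1 + c / θ) * Real.exp (θ * H)) := by gcongr
    _ = ‖L‖ * (1 + c / θ) * Real.exp (θ * H) := by ring

/-- The values of `L` on vectors of norm `≤ 1` are in the class with the same constant:
`|L v| ≤ ‖L‖ (1 + c/θ) e^{θ H(x)}`. [folklore] -/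
theorem abs_clm_unit_le_exp_hamiltonian (hω : 0 < ω₂) (hl : 0 ≤ lam) (hβ : 0 ≤ β) (γ : ℝ)
    {θ : ℝ} (hθ : 0 < θ) (L : PhaseSpace n →L[ℝ] ℝ) {v : PhaseSpace n} (hv : ‖v‖ ≤ 1)
    (x : PhaseSpace n) :
    |L v| ≤ ‖L‖ * (1 + 2 * max ω₂⁻¹ 1 / θ) *
      Real.exp (θ * (pinnedChain ω₂ lam β γ).hamiltonian n x) := by
  have hH0 : 0 ≤ (pinnedChain ω₂ lam β γ).hamiltonian n x :=
    pinnedChain_hamiltonian_nonneg hω.le hl hβ γ n x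
  have h1 : |L v| ≤ ‖L‖ * ‖v‖ := by
    have := L.le_opNorm v; rwa [Real.norm_eq_abs] at this
  have he1 : 1 ≤ Real.exp (θ * (pinnedChain ω₂ lam β γ).hamiltonian n x) :=
    Real.one_le_exp (by positivity)
  have hk : 1 ≤ 1 + 2 * max ω₂⁻¹ 1 / θ := by
    have : 0 ≤ 2 * max ω₂⁻¹ 1 / θ := by positivity
    linarith
  calc |L v| ≤ ‖L‖ * ‖v‖ := h1
    _ ≤ ‖L‖ * 1 := by gcongr
    _ = ‖L‖ * 1 * 1 := by ring
    _ ≤ ‖L‖ * (1 + 2 * max ω₂⁻¹ 1 / θ) *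
        Real.exp (θ * (pinnedChain ω₂ lam β γ).hamiltonian n x) := by gcongr

/-- The partial derivatives of a continuous linear functional are its values on the coordinate
vectors: `∂_{q_i} L = L(e_i, 0)`. [folklore] -/
theorem partialQ_clm (L : PhaseSpace n →L[ℝ] ℝ) (i : Fin n) (x : PhaseSpace n) :
    partialQ i (⇑L) x = L (unitQ i) := by
  rw [partialQ_eq_fderiv L.differentiable i, unitQ_eq]
  simp only [ContinuousLinearMap.fderiv]

/-- `∂_{p_i} L = L(0, e_i)`. [folklore] -/
theorem partialP_clm (L : PhaseSpace n →L[ℝ] ℝ) (i : Fin n) (x : PhaseSpace n) :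
    partialP i (⇑L) x = L (unitP i) := by
  rw [partialP_eq_fderiv L.differentiable i, unitP_eq]
  simp only [ContinuousLinearMap.fderiv]

/-- **`L ∘ Y = X_H L - γ ∑_i w_i p_i L(e_{p_i})`**: a linear functional along the Langevin
drift is the Liouville operator applied to it minus the friction term. [folklore] -/
theorem clm_drift_eq (γ : ℝ) (L : PhaseSpace n →L[ℝ] ℝ) (x : PhaseSpace n) :
    L ((pinnedChain ω₂ lam β γ).drift n x) =
      (∑ i, (x.2 i * partialQ i (⇑L) x -
        partialQ i ((pinnedChain ω₂ lam β γ).hamiltonian n) x * partialP i (⇑L) x)) -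
      γ * ∑ i, OscillatorChain.bathWeight n i * x.2 i * L (unitP i) := by
  rw [clm_apply_eq_sum L]
  simp only [OscillatorChain.drift, partialQ_clm, partialP_clm, smul_eq_mul, Finset.mul_sum,
    ← Finset.sum_sub_distrib, ← Finset.sum_add_distrib]
  refine Finset.sum_congr rfl fun i _ => ?_
  rw [show (pinnedChain ω₂ lam β γ).γ = γ from rfl]
  ring

end Helpers

/-- **The Koopman dissipation identity for linear functionals under the Gibbs measure.** For
every chain `pinnedChain ω₂ lam β γ` (`ω₂ > 0`, `lam, β ≥ 0`), `T > 0`, and every continuous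
linear functional `L` on phase space: `∫ L(x) L(Y x) dμ_T(x) = -γ T ∑_i w_i L(0, e_i)²`, `Y` the
Langevin drift, `w_i = [i = 0] + [i = n-1]` — the `t = 0` case of the Bakry–Émery identity
`⟨f, 𝓛f⟩ = -γT ∑_b w_b ‖∂_{p_b} f‖²` in `L²(μ_T)` for linear `f` (the Liouville part is
antisymmetric in `L²(μ_T)`, the friction part is Stein's identity). [folklore] -/
theorem gibbs_clm_mul_clm_drift : ∀ ω₂ lam β γ : ℝ, 0 < ω₂ → 0 ≤ lam → 0 ≤ β → ∀ T : ℝ, 0 < T → ∀ (n : ℕ) (L : PhaseSpace n →L[ℝ] ℝ), ∫ x, L x * L ((pinnedChain ω₂ lam β γ).drift n x) ∂((pinnedChain ω₂ lam β γ).gibbsMeasure n T) = -(γ * T) * ∑ i : Fin n, OscillatorChain.bathWeight n i * (L ((0, Pi.single i 1) : PhaseSpace n)) ^ 2 := by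
  intro ω₂ lam β γ hω hl hβ T hT n L
  set P := pinnedChain ω₂ lam β γ with hP
  -- the growth class: `θ = 1/(4T) < 1/(2T)`, constant `Cu = ‖L‖ (1 + c/θ)`
  set θ : ℝ := 1 / (4 * T) with hθdef
  have hθ0 : 0 < θ := by positivity
  have hθ : θ < 1 / (2 * T) := by
    rw [hθdef]
    exact one_div_lt_one_div_of_lt (by positivity) (by linarith)
  set Cu : ℝ := ‖L‖ * (1 + 2 * max ω₂⁻¹ 1 / θ) with hCu
  have hule : ∀ x, |L x| ≤ Cu * Real.exp (θ * P.hamiltonian n x) := fun x =>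
    abs_clm_le_exp_hamiltonian hω hl hβ γ hθ0 L x
  have huq : ∀ x i, |partialQ i (⇑L) x| ≤ Cu * Real.exp (θ * P.hamiltonian n x) := by
    intro x i
    rw [partialQ_clm]
    exact abs_clm_unit_le_exp_hamiltonian hω hl hβ γ hθ0 L (norm_unitQ_le_one i) x
  have hup : ∀ x i, |partialP i (⇑L) x| ≤ Cu * Real.exp (θ * P.hamiltonian n x) := by
    intro x i
    rw [partialP_clm]
    exact abs_clm_unit_le_exp_hamiltonian hω hl hβ γ hθ0 L (norm_unitP_le_one i) x
  -- the Liouville part vanishes: `∫ L (X_H L) ρ = 0` by antisymmetry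
  have hB := integral_liouville_mul_eq_neg hω hl hβ γ n hT hθ L.contDiff L.contDiff hule huq hup
    hule huq hup
  have hcomm : ∫ x, (∑ i, (x.2 i * partialQ i (⇑L) x -
      partialQ i (P.hamiltonian n) x * partialP i (⇑L) x)) * L x * P.gibbsDensity n T x =
      ∫ x, L x * (∑ i, (x.2 i * partialQ i (⇑L) x -
        partialQ i (P.hamiltonian n) x * partialP i (⇑L) x)) * P.gibbsDensity n T x :=
    integral_congr_ae (Eventually.of_forall fun x => by simp only; ring)
  rw [hcomm] at hB
  have h0 : ∫ x, L x * (∑ i, (x.2 i * partialQ i (⇑L) x -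
      partialQ i (P.hamiltonian n) x * partialP i (⇑L) x)) * P.gibbsDensity n T x = 0 := by
    linarith
  have hA0 : ∫ x, L x * (∑ i, (x.2 i * partialQ i (⇑L) x -
      partialQ i (P.hamiltonian n) x * partialP i (⇑L) x)) ∂(P.gibbsMeasure n T) = 0 := by
    rw [P.integral_gibbsMeasure, h0, mul_zero]
  -- integrability of the Liouville part against the Gibbs measure
  have hIsite :=
    integrable_liouvilleSite_mul hω hl hβ γ n hT hθ L.contDiff L.continuous huq hup hule
  have hIA : Integrable (fun x => L x * (∑ i, (x.2 i * partialQ i (⇑L) x -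
      partialQ i (P.hamiltonian n) x * partialP i (⇑L) x))) (P.gibbsMeasure n T) := by
    refine P.integrable_gibbsMeasure ?_
    refine (integrable_finsetSum Finset.univ fun i _ => hIsite i).congr
      (Eventually.of_forall fun x => ?_)
    simp only [Finset.mul_sum, Finset.sum_mul]
    exact Finset.sum_congr rfl fun i _ => by ring
  -- the friction part: Stein's identity `∫ p_i L dμ_T = T L(e_{p_i})`
  have hgb : ∀ x, |L x| ≤ ‖L‖ * ‖x‖ := fun x => by
    have := L.le_opNorm x; rwa [Real.norm_eq_abs] at this
  have hIp : ∀ i, Integrable (fun x : PhaseSpace n => x.2 i * L x) (P.gibbsMeasure n T) := by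
    intro i
    refine integrable_gibbsMeasure_of_growth hω hl hβ hT
      ((by fun_prop : Continuous fun x : PhaseSpace n => x.2 i).mul L.continuous) (A := ‖L‖)
      fun x => ?_
    have h1 := OscillatorChain.abs_snd_apply_le_norm x i
    have h4 := (pow_le_one_add_sq_sq (norm_nonneg x)).2.1
    rw [abs_mul]
    calc |x.2 i| * |L x| ≤ ‖x‖ * (‖L‖ * ‖x‖) :=
          mul_le_mul h1 (hgb x) (abs_nonneg _) (norm_nonneg _)
      _ = ‖L‖ * ‖x‖ ^ 2 := by ring
      _ ≤ ‖L‖ * (1 + ‖x‖ ^ 2) ^ 2 := by nlinarith [norm_nonneg L]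
  have hIF : Integrable (fun x : PhaseSpace n =>
      γ * ∑ i, OscillatorChain.bathWeight n i * L (unitP i) * (x.2 i * L x))
      (P.gibbsMeasure n T) :=
    (integrable_finsetSum Finset.univ fun i _ => (hIp i).const_mul _).const_mul γ
  have hS : ∀ i, ∫ x, x.2 i * L x ∂(P.gibbsMeasure n T) = T * L (unitP i) := fun i =>
    gibbs_momentum_mul_clm hω hl hβ hT i L
  -- assemble
  have hpt : ∀ x, L x * L (P.drift n x) =
      L x * (∑ i, (x.2 i * partialQ i (⇑L) x -
        partialQ i (P.hamiltonian n) x * partialP i (⇑L) x)) -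
        γ * ∑ i, OscillatorChain.bathWeight n i * L (unitP i) * (x.2 i * L x) := fun x => by
    rw [clm_drift_eq]
    simp only [mul_sub, Finset.mul_sum]
    congr 1
    exact Finset.sum_congr rfl fun i _ => by ring
  calc ∫ x, L x * L (P.drift n x) ∂(P.gibbsMeasure n T)
      = ∫ x, (L x * (∑ i, (x.2 i * partialQ i (⇑L) x - partialQ i (P.hamiltonian n) x *
          partialP i (⇑L) x)) -
          γ * ∑ i, OscillatorChain.bathWeight n i * L (unitP i) * (x.2 i * L x))
          ∂(P.gibbsMeasure n T) :=
        integral_congr_ae (Eventually.of_forall hpt)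
    _ = 0 - γ * ∑ i, OscillatorChain.bathWeight n i * L (unitP i) * (T * L (unitP i)) := by
        rw [integral_sub hIA hIF, hA0, integral_const_mul,
          integral_finsetSum _ fun i _ => (hIp i).const_mul _]
        congr 2
        exact Finset.sum_congr rfl fun i _ => by rw [integral_const_mul, hS i]
    _ = -(γ * T) * ∑ i : Fin n,
          OscillatorChain.bathWeight n i * (L ((0, Pi.single i 1) : PhaseSpace n)) ^ 2 := by
        rw [zero_sub, Finset.mul_sum, Finset.mul_sum, ← Finset.sum_neg_distrib]
        exact Finset.sum_congr rfl fun i _ => by rw [unitP_eq]; ring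

end Summit.AtomisticToContinuum.FouriersLaw.Theorems.PhononMeanFreePath

end
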